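import Summits.BirchSwinnertonDyer.Rank1Residual.P2.CongruentNumberPairsAtTwoSilentFiveDoor
import Summits.BirchSwinnertonDyer.Rank1Residual.P2.TianFamilySevenAtTwo
import Literature.NumberTheory.EllipticCurves.Tian2014.ClassFiveFamilyDescentProofs
import HarnessLib

/-!
# Sub-lane «bsd-p2»: the ODD cell tables at `k = 1, 2` as KERNEL theorems — Monsky's `s(n)` and the
# genus condition of DOOR A on every configuration of one or two odd primes (p2-typer GEN 22 terms;
# W0 docstrings typer GEN 62, T-186 — W0 candidate for SWEEP 2026-08-24 ORDER 2)

HONEST FRAMING (sub-lane «bsd-p2», run/shared/lean/b2b/bsd-rank1-residual/p2/, verbatim in every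
file): the target of record is the FULL Birch–Swinnerton-Dyer formula for EVERY analytic-rank `≤ 1`
`E/ℚ` at ALL primes INCLUDING `2`; the odd-prime class ledger is referee A's; the `2`-part is OPEN
(cells O1 = X5 ∖ CM and O12 = the CM corner) and under census by «bsd-p2». Census / instrument
output at `2` = EVIDENCE / conjecture items with held-out validation, NEVER a Literature fact;
certificates close PAIRS (one isogeny class, `p = 2`), never classes. This file asserts NO
arithmetic fact about any curve: §1–§2 are SELECTION-SIDE statements about one or two odd primes
(residues mod `8`, Legendre bits, Monsky's matrix over `𝔽₂`), §3 are genus-class-number parities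
MODULO the displayed Rédei–Reichardt fact `hR`, §4 is DOOR A (`P2/CongruentNumberPairsAtTwoGenusPointData`)
specialised to pairs, a CONDITIONAL kernel theorem under the displayed binders `hTYZ` (TYZ §3),
`hGZK`, `hM` (Monsky 1994 odd), `hR`. WHAT IT DOES (the odd twin of the `k = 2` EVEN cell table,
p2-typer GEN 21 T-155). For a prime `p ≡ 5, 7 (mod 8)`: Monsky's matrix has a `2`-element
kernel (`s(p) = 1`) and `Σ₁(p) = g(p)` is odd. For `n = t₀t₁ ≡ 5, 7 (mod 8)`
(distinct odd primes): `s(n) = 1` iff NOT (one `tᵢ ≡ 1 (mod 8)` and `(t₁/t₀) = +1`) — one `decide`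
over the `64 × 2` residue/bit configurations (§1), transferred to primes by quadratic reciprocity
(§2) — and on EVERY `s(n) = 1` configuration the genus condition `Σ₁(n)` odd or `Σ₂′(n)` odd HOLDS
(§3: `p₃q₅`, `p₃q₇` from the landed family lemmas; `p₁q₅`, `p₁q₇` with `(q/p) = −1` from lit-1's
class-`5` / class-`7` Rédei computations) — so at `k ≤ 2` there is NO silent odd cell: §4 closes
every odd pair with `s = 1` modulo the four displayed facts. Nothing booked; no mark moved; no
`ℓ = 4` integer (the odd `k ≤ 3` regime is ATLAS-A3's charted one). Unit `b2b-bsdres-p2-typer`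
GEN 22 (terms) / GEN 62 (W0 docstring refresh T-186, decl terms byte-identical); W0 candidate for SWEEP
2026-08-24 ORDER 2 (door-side bookkeeping; `U₃⁰` UNMEASURED; no registration rides on this file).

References: [HeathBrown1994SelmerCongruentII] Appendix (Monsky), typescript p. 39 L10–L33;
[TianYuanZhang2017] Thm 1.2, Thm 3.5, §1 (1.1); [Tian2014] Lemma 5.1, (5.1); [LiMa2008] Thm 0.4;
[IrelandRosen1990] Ch. 5 §1–§2; [Miller2011LMS] Def 1.1; HOME/p2/typer/lean/conjectures/GEN21-EVEN-RUNG-TWO.md.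
-/

noncomputable section

open scoped Classical

open Matrix Finset WeierstrassCurve NumberField Literature.NumberTheory.EllipticCurves
  Literature.NumberTheory.EllipticCurves.Rank1Residual
  Literature.NumberTheory.EllipticCurves.Rank1Residual.Typed
  Literature.NumberTheory.EllipticCurves.Monsky1990
  Literature.NumberTheory.EllipticCurves.HeathBrown1994
  Literature.NumberTheory.EllipticCurves.TianYuanZhang2017
  Literature.NumberTheory.EllipticCurves.Tian2014
  Literature.NumberTheory.QuadraticFields.RedeiReichardt

set_option autoImplicit false

namespace Summit.BirchSwinnertonDyer.Rank1Residual.P2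

/-! ## §1 The finite censuses at `ω(n) = 1, 2` (configurations; one `decide` each) -/

section Census

/-- **`ω = 1`**: for a residue `r ≡ 5, 7 (mod 8)` Monsky's `2 × 2` matrix `(χ₈ χ₈; χ₈ χ₈+χ₄)` read on
the configuration has a `2`-element kernel (`s = 1`); `decide`.
[cite: HeathBrown1994SelmerCongruentII, Appendix (Monsky), typescript p. 39 L27–L33] -/
theorem card_ker_monskyCfgOdd_one : ∀ r₀ : Fin 8, (r₀.val = 5 ∨ r₀.val = 7) →
    Fintype.card {v : Fin 1 ⊕ Fin 1 → ZMod 2 //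
      monskyCfgOdd ![r₀.val] ![![(0 : ZMod 2)]] *ᵥ v = 0} = 2 := by
  decide

/-- **`ω = 2`: THE ODD PAIR TABLE.** For residues `r₀, r₁` with `r₀r₁ ≡ 5, 7 (mod 8)` and the upper
symbol bit `s = [(t₁/t₀) = −1]` (the lower one by reciprocity: `s + χ₄(r₀)χ₄(r₁)`), Monsky's `4 × 4`
matrix has a `2`-element kernel iff NOT (`s = 0` and one residue is `1`): `s = 1` on twelve of the
sixteen configurations, the kernel has `8` elements (`s = 3`) on `(1, 5∨7; +1)`, `(5∨7, 1; +1)`. `decide`.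
[cite: HeathBrown1994SelmerCongruentII, Appendix (Monsky), typescript p. 39 L27–L33]
[cite: IrelandRosen1990, Ch. 5 §2 Thm. 1 (quadratic reciprocity)] -/
theorem card_ker_monskyCfgOdd_two_iff : ∀ (r₀ r₁ : Fin 8) (s : ZMod 2),
    ((r₀.val * r₁.val) % 8 = 5 ∨ (r₀.val * r₁.val) % 8 = 7) →
    (Fintype.card {v : Fin 2 ⊕ Fin 2 → ZMod 2 //
        monskyCfgOdd ![r₀.val, r₁.val]
          ![![0, s], ![s + chi4Bit r₀.val * chi4Bit r₁.val, 0]] *ᵥ v = 0} = 2 ↔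
      ¬ (s = 0 ∧ (r₀.val = 1 ∨ r₁.val = 1))) := by
  decide

/-- The complementary count: on the four configurations `(1, 5∨7; +1)`, `(5∨7, 1; +1)` the kernel
has `8` elements (`s = 3`). `decide`.
[cite: HeathBrown1994SelmerCongruentII, Appendix (Monsky), typescript p. 39 L27–L33] -/
theorem card_ker_monskyCfgOdd_two_eq_eight : ∀ (r₀ r₁ : Fin 8),
    ((r₀.val * r₁.val) % 8 = 5 ∨ (r₀.val * r₁.val) % 8 = 7) → (r₀.val = 1 ∨ r₁.val = 1) →
    Fintype.card {v : Fin 2 ⊕ Fin 2 → ZMod 2 //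
        monskyCfgOdd ![r₀.val, r₁.val]
          ![![0, (0 : ZMod 2)], ![0 + chi4Bit r₀.val * chi4Bit r₁.val, 0]] *ᵥ v = 0} = 8 := by
  decide

end Census

/-! ## §2 Transfer to one / two primes (quadratic reciprocity packages the configuration) -/

section Transfer

/-- The configuration of ONE odd prime: residue `p mod 8`, no symbol bit (`kroneckerBit_self`).
[cite: IrelandRosen1990, Ch. 5 §1 Prop. 5.1.2] -/
theorem cfg_one_eq (p : Fin 1 → ℕ) (hp : ∀ i, (p i).Prime) :
    ∃ r₀ : Fin 8, r₀.val = p 0 % 8 ∧ (fun i => p i % 8) = ![r₀.val] ∧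
      (fun a b => kroneckerBit (p b) (p a)) = ![![(0 : ZMod 2)]] := by
  refine ⟨⟨p 0 % 8, Nat.mod_lt _ (by norm_num)⟩, rfl, ?_, ?_⟩
  · funext i; fin_cases i; rfl
  · funext a b
    fin_cases a; fin_cases b
    simpa using kroneckerBit_self (hp 0)

/-- The configuration of a PAIR of distinct odd primes: residues and the upper bit
`s = [(p₁/p₀) = −1]`, the lower bit `s + χ₄χ₄` by quadratic reciprocity (`kroneckerBit_swap`).
[cite: IrelandRosen1990, Ch. 5 §2 Thm. 1 (quadratic reciprocity)] -/
theorem cfg_two_eq (p : Fin 2 → ℕ) (hp : ∀ i, (p i).Prime) (hp2 : ∀ i, p i ≠ 2)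
    (hinj : Function.Injective p) :
    ∃ r₀ r₁ : Fin 8, (r₀.val = p 0 % 8 ∧ r₁.val = p 1 % 8) ∧
      (fun i => p i % 8) = ![r₀.val, r₁.val] ∧
      (fun a b => kroneckerBit (p b) (p a)) =
        ![![0, kroneckerBit (p 1) (p 0)],
          ![kroneckerBit (p 1) (p 0) + chi4Bit r₀.val * chi4Bit r₁.val, 0]] := by
  have h01 : p 0 ≠ p 1 := fun h => absurd (hinj h) (by decide)
  refine ⟨⟨p 0 % 8, Nat.mod_lt _ (by norm_num)⟩, ⟨p 1 % 8, Nat.mod_lt _ (by norm_num)⟩, ⟨rfl, rfl⟩,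
    ?_, ?_⟩
  · funext i; fin_cases i <;> rfl
  · funext a b
    fin_cases a <;> fin_cases b
    · simpa using kroneckerBit_self (hp 0)
    · simp
    · simp [chi4Bit_mod_eight, kroneckerBit_swap (hp 0) (hp 1) (hp2 0) (hp2 1) h01]
    · simpa using kroneckerBit_self (hp 1)

/-- **`s(p) = 1` for every prime `p ≡ 5, 7 (mod 8)`** (Monsky's `2·1 − rank M`; linear algebra only).
[cite: HeathBrown1994SelmerCongruentII, Appendix (Monsky), typescript p. 39 L33] -/
theorem card_ker_monskyMatrixOdd_prime (t : Fin 1 → ℕ) (ht : ∀ i, (t i).Prime)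
    (h8 : t 0 % 8 = 5 ∨ t 0 % 8 = 7) :
    Fintype.card {v : Fin 1 ⊕ Fin 1 → ZMod 2 // monskyMatrixOdd t *ᵥ v = 0} = 2 := by
  have ht2 : ∀ i, t i ≠ 2 := fun i => by fin_cases i; intro h; simp only [Fin.zero_eta] at h; omega
  have hinj : Function.Injective t := fun i j _ => Subsingleton.elim i j
  rw [card_ker_monskyMatrixOdd_eq_cfg t ht ht2 hinj]
  obtain ⟨r₀, e₀, hRes, hB⟩ := cfg_one_eq t ht
  rw [hRes, hB]
  exact card_ker_monskyCfgOdd_one r₀ (by omega)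

/-- `s(p) = 1` for a prime `p ≡ 5, 7 (mod 8)`, in Monsky's rank form.
[cite: HeathBrown1994SelmerCongruentII, Appendix (Monsky), typescript p. 39 L33] -/
theorem monskySelmerRankOdd_prime_eq_one (t : Fin 1 → ℕ) (ht : ∀ i, (t i).Prime)
    (h8 : t 0 % 8 = 5 ∨ t 0 % 8 = 7) : monskySelmerRankOdd t = 1 :=
  (monskySelmerRankOdd_eq_one_iff_card_ker t).mpr (card_ker_monskyMatrixOdd_prime t ht h8)

/-- **THE ODD PAIR TABLE ON PRIMES.** For distinct odd primes `t₀, t₁` with `t₀t₁ ≡ 5, 7 (mod 8)`: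
`s(t₀t₁) = 1` iff NOT (`(t₁/t₀) = +1` and one of `t₀, t₁` is `≡ 1 (mod 8)`).
[cite: HeathBrown1994SelmerCongruentII, Appendix (Monsky), typescript p. 39 L27–L33]
[cite: IrelandRosen1990, Ch. 5 §1 Prop. 5.1.2 and §2 Thm. 1] -/
theorem monskySelmerRankOdd_pair_eq_one_iff (t : Fin 2 → ℕ) (ht : ∀ i, (t i).Prime)
    (ht2 : ∀ i, t i ≠ 2) (hinj : Function.Injective t)
    (h8 : (t 0 * t 1) % 8 = 5 ∨ (t 0 * t 1) % 8 = 7) :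
    monskySelmerRankOdd t = 1 ↔ ¬ (jacobiSym (t 1) (t 0) = 1 ∧ (t 0 % 8 = 1 ∨ t 1 % 8 = 1)) := by
  rw [monskySelmerRankOdd_eq_one_iff_card_ker, card_ker_monskyMatrixOdd_eq_cfg t ht ht2 hinj]
  obtain ⟨r₀, r₁, ⟨e₀, e₁⟩, hRes, hB⟩ := cfg_two_eq t ht ht2 hinj
  rw [hRes, hB]
  have h8r : (r₀.val * r₁.val) % 8 = 5 ∨ (r₀.val * r₁.val) % 8 = 7 := by
    rw [e₀, e₁, ← Nat.mul_mod]; exact h8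
  rw [card_ker_monskyCfgOdd_two_iff r₀ r₁ (kroneckerBit (t 1) (t 0)) h8r]
  have h10 : t 1 ≠ t 0 := fun h => absurd (hinj h) (by decide)
  have hs : kroneckerBit (t 1) (t 0) = 0 ↔ jacobiSym (t 1) (t 0) = 1 := by
    rw [kroneckerBit_eq_bitOf (ht 0) (ht2 0) (intCast_natCast_prime_ne_zero (ht 1) (ht 0) h10)]
    have hv := jacobiSym.eq_one_or_neg_one (int_gcd_prime_eq_one (ht 1) (ht 0) h10)
    unfold bitOf
    rcases hv with h | h <;> simp [h]
  rw [hs, e₀, e₁]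

/-- On the `s = 1` locus a pair with a prime `≡ 1 (mod 8)` has `(t₁/t₀) = −1`.
[cite: HeathBrown1994SelmerCongruentII, Appendix (Monsky), typescript p. 39 L27–L33] -/
theorem jacobiSym_eq_neg_one_of_monskySelmerRankOdd_pair (t : Fin 2 → ℕ) (ht : ∀ i, (t i).Prime)
    (ht2 : ∀ i, t i ≠ 2) (hinj : Function.Injective t)
    (h8 : (t 0 * t 1) % 8 = 5 ∨ (t 0 * t 1) % 8 = 7) (hs : monskySelmerRankOdd t = 1)
    (h1 : t 0 % 8 = 1 ∨ t 1 % 8 = 1) : jacobiSym (t 1) (t 0) = -1 := by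
  have h10 : t 1 ≠ t 0 := fun h => absurd (hinj h) (by decide)
  have hv := jacobiSym.eq_one_or_neg_one (int_gcd_prime_eq_one (ht 1) (ht 0) h10)
  have key := (monskySelmerRankOdd_pair_eq_one_iff t ht ht2 hinj h8).mp hs
  rcases hv with h | h
  · exact absurd ⟨h, h1⟩ key
  · exact h

end Transfer

/-! ## §3 The genus condition on the four `s = 1` pair classes with a prime `≡ 1 (mod 8)`
(mod Rédei–Reichardt ONLY; the classes `p₃q₅`, `p₃q₇` are the landed family lemmas
`odd_genusSum_genusField_three_five'`, `odd_genusSum_genusField_three_seven`) -/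

section GenusSide

/-- The odd graph of a pair `(q, p)` with `p ≡ 1 (mod 4)` and `(p/q) = −1` (`q` an odd prime): Monsky's
`A = legendreMatrix (q, p) = (1 1; 1 1)` (by reciprocity `(q/p) = (p/q)`), kernel `{0, (1,1)}` — the
`k = 1` odd-graph condition of Tian's class-`5` / class-`7` families, for either residue of `q`.
[cite: Tian2014, Lemma 5.1 (the graph G)] [cite: IrelandRosen1990, Ch. 5 §2 Thm. 1 (quadratic reciprocity)] -/
theorem oddGraph_pair_of_jacobiSym_eq_neg_one {p q : ℕ} (hq : q.Prime) (hq2 : q ≠ 2) (hp4 : p % 4 = 1)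
    (hJ : jacobiSym p q = -1) :
    ∀ v, legendreMatrix ![q, p] *ᵥ v = 0 → v = 0 ∨ v = fun _ => 1 := by
  have hqp : jacobiSym q p = -1 := by
    rw [jacobiSym.quadratic_reciprocity_one_mod_four' (hq.odd_of_ne_two hq2) hp4, hJ]
  have a01 : addLegendreSym (p : ℤ) q = 1 := addLegendreSym_of_eq_neg_one (by exact_mod_cast hJ)
  have a10 : addLegendreSym (q : ℤ) p = 1 := addLegendreSym_of_eq_neg_one (by exact_mod_cast hqp)
  have e : legendreMatrix ![q, p] = !![1, 1; 1, 1] := by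
    have e0 : (Finset.univ : Finset (Fin 2)).erase 0 = {1} := by decide
    have e1 : (Finset.univ : Finset (Fin 2)).erase 1 = {0} := by decide
    ext i j
    simp only [legendreMatrix, Matrix.of_apply]
    fin_cases i <;> fin_cases j <;> simp [e0, e1, a01, a10]
  rw [e]
  decide

/-- **`g(p)` is EVEN for a prime `p ≡ 1 (mod 8)`**, modulo Rédei–Reichardt (`disc = −4p`, the Rédei
matrix vanishes, `r₄ = 1`): lit-1's `even_genusClassNumber_of_dvd_caseSeven` at the divisor `p` of `3·p`.
[cite: TianYuanZhang2017, proof of Cor. 1.4 (chunk p0003 L36–L49)] [cite: LiMa2008, Thm. 0.4 with Lemma 0.1] -/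
theorem even_genusClassNumber_genusField_prime_one (hR : redeiReichardt_fourTwoCard_classGroup)
    {p : ℕ} (hp : p.Prime) (hp1 : p % 8 = 1) : Even (genusClassNumber (GenusField p)) := by
  have h3p : (3 : ℕ) ≠ p := fun h => by omega
  have hinj : Function.Injective (![3, p] : Fin 2 → ℕ) := by
    intro i j h
    fin_cases i <;> fin_cases j <;> simp_all [h3p.symm]
  refine even_genusClassNumber_of_dvd_caseSeven (k := 1) ![3, p] hR
    (fun i => by fin_cases i <;> [exact Nat.prime_three; exact hp]) hinj
    (fun i hi => by fin_cases i <;> simp_all) (d := p) ?_ ?_ hp.one_lt (GenusField p)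
    (isQuadraticFieldOfSqrt_genusField hp.one_lt.le)
  · rw [Fin.prod_univ_two]; exact dvd_mul_left p 3
  · intro h
    exact h3p ((Nat.prime_dvd_prime_iff_eq Nat.prime_three hp).mp h)

/-- **Class `p₁·q₅`, `(q/p) = −1`: `Σ₂′(pq)` is ODD** (mod `hR`): `Σ₂′(pq) = g(p)·g(q) + g(pq)`
(`genusSum₂_prime_mul`, `genusSum₂'_eq_genusSum₂_add_self`) with `g(p)` even (`p ≡ 1 (mod 8)`) and
`g(pq)` odd (lit-1's class-`5` odd-graph Rédei computation `odd_genusClassNumber_caseFive` at `k = 1`).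
[cite: TianYuanZhang2017, Thm. 1.2 (Σ₂) and Cor. 1.4] [cite: LiMa2008, Thm. 0.4] -/
theorem odd_genusSum₂'_genusField_one_five (hR : redeiReichardt_fourTwoCard_classGroup) {p q : ℕ}
    (hp : p.Prime) (hq : q.Prime) (hp1 : p % 8 = 1) (hq5 : q % 8 = 5) (hJ : jacobiSym q p = -1) :
    Odd (genusSum₂' (p * q) fun d => genusClassNumber (GenusField d)) := by
  have hne : p ≠ q := fun h => by omega
  have hn1 : 1 < p * q := one_lt_mul'' hp.one_lt hq.one_lt
  have h8 : (p * q) % 8 = 5 := by rw [Nat.mul_mod, hp1, hq5]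
  have hinj : Function.Injective (![q, p] : Fin 2 → ℕ) := by
    intro i j h
    fin_cases i <;> fin_cases j <;> simp_all [hne.symm]
  -- `(p/q) = −1` from `(q/p) = −1` (both `≡ 1 (mod 4)`)
  have hJ' : jacobiSym p q = -1 := by
    rw [jacobiSym.quadratic_reciprocity_one_mod_four (by omega : p % 4 = 1)
      (hq.odd_of_ne_two (fun h => by omega)), hJ]
  have hgpq : Odd (genusClassNumber (GenusField (p * q))) :=
    odd_genusClassNumber_caseFive (k := 1) ![q, p] hR (fun i => by fin_cases i <;> assumption) hinj
      (fun i => by fin_cases i <;> simp <;> omega) (by simp [Fin.prod_univ_two]; rw [Nat.mul_mod, hq5, hp1])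
      (oddGraph_pair_of_jacobiSym_eq_neg_one hq (fun h => by omega) (by omega) hJ')
      (by simp [Fin.prod_univ_two, mul_comm]) (GenusField (p * q))
      (isQuadraticFieldOfSqrt_genusField hn1.le)
  rw [genusSum₂'_eq_genusSum₂_add_self hn1 (Or.inl h8),
    genusSum₂_prime_mul hp hq hne (Or.inl hp1) (Or.inl hq5)]
  exact Even.add_odd ((even_genusClassNumber_genusField_prime_one hR hp hp1).mul_right _) hgpq

/-- **Class `p₁·q₇`, `(q/p) = −1`: `Σ₁(pq)` is ODD** (mod `hR`) — lit-1's `odd_genusSum₁_caseSeven` on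
Tian's class-`7` family at `k = 1` (tuple `(q, p)`, odd graph by `(p/q) = (q/p) = −1`).
[cite: Tian2014, Lemma 5.1, Lemma 5.3] [cite: TianYuanZhang2017, Thm. 1.2 (Σ₁)] [cite: LiMa2008, Thm. 0.4] -/
theorem odd_genusSum₁_genusField_one_seven (hR : redeiReichardt_fourTwoCard_classGroup) {p q : ℕ}
    (hp : p.Prime) (hq : q.Prime) (hp1 : p % 8 = 1) (hq7 : q % 8 = 7) (hJ : jacobiSym q p = -1) :
    Odd (genusSum₁ (p * q) fun d => genusClassNumber (GenusField d)) := by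
  have hne : p ≠ q := fun h => by omega
  have hinj : Function.Injective (![q, p] : Fin 2 → ℕ) := by
    intro i j h
    fin_cases i <;> fin_cases j <;> simp_all [hne.symm]
  have hJ' : jacobiSym p q = -1 := by
    rw [jacobiSym.quadratic_reciprocity_one_mod_four (by omega : p % 4 = 1)
      (hq.odd_of_ne_two (fun h => by omega)), hJ]
  exact odd_genusSum₁_caseSeven (k := 1) ![q, p] hR (fun i => by fin_cases i <;> assumption) hinj hq7
    (fun i hi => by fin_cases i <;> simp_all) (oddGraph_one_seven hq hp1 hq7 hJ')
    (by simp [Fin.prod_univ_two, mul_comm])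

end GenusSide

/-! ## §4 DOOR A on a pair / a prime: every odd `s = 1` cell at `k ≤ 2` is LOUD, hence closed modulo
{`hTYZ`, `hGZK`, `hM`, `hR`} -/

section Door

/-- DOOR A (`rankOne_sha_bsdp_two_congruentNumberCurve_of_genusPointData`) with the table inputs in
canonical form: a tuple of distinct odd primes, `∏ t = n ≡ 5, 7 (mod 8)`, `s(t) = 1` (Monsky's rank form)
and the genus condition ⟹ `r_an = 1`, rank `1`, `Ш[2^∞] = 0`, `BSD(E_n, 2)`.
[cite: TianYuanZhang2017, Thm. 1.2, Thm. 3.5 and §1 (1.1)]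
[cite: HeathBrown1994SelmerCongruentII, Appendix (Monsky), typescript p. 39 L10–L33]
[cite: Miller2011LMS, Def. 1.1 (arXiv:1010.2431 p. 3)] -/
theorem rankOne_sha_bsdp_two_congruentNumberCurve_of_monskySelmerRankOdd_of_genus {k : ℕ}
    (t : Fin k → ℕ) (hTYZ : tyz_genusPointData)
    (hGZK : rank_eq_analyticRank_of_analyticRank_le_one) (hM : monsky_card_selmerGroup_two_odd)
    (ht : ∀ i, (t i).Prime) (hinj : Function.Injective t) {n : ℕ} (hn : ∏ i, t i = n)
    (h8 : n % 8 = 5 ∨ n % 8 = 7) (hs : monskySelmerRankOdd t = 1)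
    (hgen : Odd (genusSum₁ n fun d => genusClassNumber (GenusField d)) ∨
      Odd (genusSum₂' n fun d => genusClassNumber (GenusField d))) :
    (congruentNumberCurve n).analyticRank = 1 ∧ (congruentNumberCurve n).mordellWeilRank = 1 ∧
      AddCommGroup.primaryComponent (congruentNumberCurve n).sha 2 = ⊥ ∧
      BSDp (congruentNumberCurve n) 2 := by
  have ht2 : ∀ i, t i ≠ 2 := by
    intro i hi
    have hdvd : t i ∣ n := hn ▸ Finset.dvd_prod_of_mem t (Finset.mem_univ i)
    rw [hi] at hdvd
    rcases h8 with h | h <;> omega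
  have hodd : ∀ i, Odd (t i) := fun i => (ht i).odd_of_ne_two (ht2 i)
  exact rankOne_sha_bsdp_two_congruentNumberCurve_of_genusPointData t hTYZ hGZK hM ht hodd hinj hn h8
    (fun i j => addLegendreSym (t j) (t i)) (fun i => addLegendreSym 2 (t i))
    (fun i => addLegendreSym (-2) (t i)) (fun _ _ => rfl) (fun _ => rfl) (fun _ => rfl)
    ((monskySelmerRankOdd_eq_one_iff_card_ker t).mp hs) hgen

/-- **RUNG ONE IS A THEOREM: every prime `p ≡ 5, 7 (mod 8)`.** `ord_{s=1} L(E_p, s) = 1`, rank `1`,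
`Ш(E_p)[2^∞] = 0`, `BSD(E_p, 2)` — modulo {`hTYZ`, `hGZK`, `hM`, `hR`}; `s(p) = 1` is §2 and
`Σ₁(p) = g(p)` is odd (`t = 1` resp. `(2/p) = −1` in Rédei's matrix).
[cite: TianYuanZhang2017, Thm. 1.2, Thm. 3.5 and §1 (1.1)] [cite: LiMa2008, Thm. 0.4]
[cite: Miller2011LMS, Def. 1.1 (arXiv:1010.2431 p. 3)] -/
theorem rankOne_sha_bsdp_two_congruentNumberCurve_prime_five_or_seven (hTYZ : tyz_genusPointData)
    (hGZK : rank_eq_analyticRank_of_analyticRank_le_one) (hM : monsky_card_selmerGroup_two_odd)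
    (hR : redeiReichardt_fourTwoCard_classGroup) {p : ℕ} (hp : p.Prime) (h8 : p % 8 = 5 ∨ p % 8 = 7) :
    (congruentNumberCurve p).analyticRank = 1 ∧ (congruentNumberCurve p).mordellWeilRank = 1 ∧
      AddCommGroup.primaryComponent (congruentNumberCurve p).sha 2 = ⊥ ∧
      BSDp (congruentNumberCurve p) 2 := by
  have hgen : Odd (genusSum₁ p fun d => genusClassNumber (GenusField d)) := by
    rw [genusSum₁_prime hp]
    rcases h8 with h5 | h7
    · exact odd_genusClassNumber_genusField_prime_five_mod_eight hR hp h5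
    · exact odd_genusClassNumber_genusField_prime hR hp (by omega)
  exact rankOne_sha_bsdp_two_congruentNumberCurve_of_monskySelmerRankOdd_of_genus ![p] hTYZ hGZK hM
    (fun i => by fin_cases i; exact hp) (fun i j _ => Subsingleton.elim i j) (by simp) h8
    (monskySelmerRankOdd_prime_eq_one ![p] (fun i => by fin_cases i; exact hp) (by simpa using h8))
    (Or.inl hgen)

/-- **RUNG TWO IS A THEOREM: every pair.** For distinct primes `t₀, t₁` with `t₀t₁ ≡ 5, 7 (mod 8)` and
`s(t₀t₁) = 1`: `ord_{s=1} L(E_n, s) = 1`, rank `1`, `Ш(E_n)[2^∞] = 0`, `BSD(E_n, 2)` (`n = t₀t₁`) —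
modulo {`hTYZ`, `hGZK`, `hM`, `hR`}. Eight ordered residue classes: `p₃q₅`, `p₃q₇` (genus condition
for every symbol, landed), `p₁q₅`, `p₁q₇` (there `s = 1` forces `(q/p) = −1`, §2, and then `Σ₂′` resp.
`Σ₁` is odd, §3). NO silent cell at `k = 2`.
[cite: TianYuanZhang2017, Thm. 1.2, Thm. 3.5 and §1 (1.1)]
[cite: HeathBrown1994SelmerCongruentII, Appendix (Monsky), typescript p. 39 L10–L33]
[cite: Miller2011LMS, Def. 1.1 (arXiv:1010.2431 p. 3)] -/
theorem rankOne_sha_bsdp_two_congruentNumberCurve_odd_pair (hTYZ : tyz_genusPointData)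
    (hGZK : rank_eq_analyticRank_of_analyticRank_le_one) (hM : monsky_card_selmerGroup_two_odd)
    (hR : redeiReichardt_fourTwoCard_classGroup) (t : Fin 2 → ℕ) (ht : ∀ i, (t i).Prime)
    (hinj : Function.Injective t) {n : ℕ} (hn : ∏ i, t i = n) (h8 : n % 8 = 5 ∨ n % 8 = 7)
    (hs : monskySelmerRankOdd t = 1) :
    (congruentNumberCurve n).analyticRank = 1 ∧ (congruentNumberCurve n).mordellWeilRank = 1 ∧
      AddCommGroup.primaryComponent (congruentNumberCurve n).sha 2 = ⊥ ∧
      BSDp (congruentNumberCurve n) 2 := by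
  have hn2 : n = t 0 * t 1 := by rw [← hn, Fin.prod_univ_two]
  have ht2 : ∀ i, t i ≠ 2 := by
    intro i hi
    have hdvd : t i ∣ n := hn ▸ Finset.dvd_prod_of_mem t (Finset.mem_univ i)
    rw [hi] at hdvd
    rcases h8 with h | h <;> omega
  have h8' : (t 0 * t 1) % 8 = 5 ∨ (t 0 * t 1) % 8 = 7 := hn2 ▸ h8
  have hne : t 0 ≠ t 1 := fun h => absurd (hinj h) (by decide)
  refine rankOne_sha_bsdp_two_congruentNumberCurve_of_monskySelmerRankOdd_of_genus t hTYZ hGZK hM ht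
    hinj hn h8 hs ?_
  -- residues of the two odd primes
  have hr0 : t 0 % 8 = 1 ∨ t 0 % 8 = 3 ∨ t 0 % 8 = 5 ∨ t 0 % 8 = 7 := by
    have := (ht 0).eq_one_or_self_of_dvd 2; have h2 := ht2 0; omega
  have hr1 : t 1 % 8 = 1 ∨ t 1 % 8 = 3 ∨ t 1 % 8 = 5 ∨ t 1 % 8 = 7 := by
    have := (ht 1).eq_one_or_self_of_dvd 2; have h2 := ht2 1; omega
  have hprod : (t 0 * t 1) % 8 = (t 0 % 8) * (t 1 % 8) % 8 := Nat.mul_mod _ _ _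
  rw [hn2]
  rcases hr0 with h0 | h0 | h0 | h0 <;> rcases hr1 with h1 | h1 | h1 | h1 <;>
    simp only [h0, h1] at hprod <;> norm_num at hprod <;>
    first
    | (exfalso; omega)
    | skip
  -- (1, 5): `(t₁/t₀) = −1`, Σ₂′ odd
  · have hJ := jacobiSym_eq_neg_one_of_monskySelmerRankOdd_pair t ht ht2 hinj h8' hs (Or.inl h0)
    exact Or.inr (odd_genusSum₂'_genusField_one_five hR (ht 0) (ht 1) h0 h1 hJ)
  -- (1, 7): Σ₁ odd
  · have hJ := jacobiSym_eq_neg_one_of_monskySelmerRankOdd_pair t ht ht2 hinj h8' hs (Or.inl h0)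
    exact Or.inl (odd_genusSum₁_genusField_one_seven hR (ht 0) (ht 1) h0 h1 hJ)
  -- (3, 5)
  · exact odd_genusSum_genusField_three_five' hR (ht 0) (ht 1) h0 h1
  -- (3, 7)
  · exact odd_genusSum_genusField_three_seven hR (ht 0) (ht 1) h0 h1
  -- (5, 1): swap
  · have hJ := jacobiSym_eq_neg_one_of_monskySelmerRankOdd_pair t ht ht2 hinj h8' hs (Or.inr h1)
    have hJ' : jacobiSym (t 0 : ℤ) (t 1) = -1 := by
      rw [jacobiSym.quadratic_reciprocity_one_mod_four' ((ht 0).odd_of_ne_two (ht2 0))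
        (by omega : t 1 % 4 = 1), hJ]
    rw [mul_comm]
    exact Or.inr (odd_genusSum₂'_genusField_one_five hR (ht 1) (ht 0) h1 h0 hJ')
  -- (5, 3): swap
  · rw [mul_comm]; exact odd_genusSum_genusField_three_five' hR (ht 1) (ht 0) h1 h0
  -- (7, 1): swap
  · have hJ := jacobiSym_eq_neg_one_of_monskySelmerRankOdd_pair t ht ht2 hinj h8' hs (Or.inr h1)
    have hJ' : jacobiSym (t 0 : ℤ) (t 1) = -1 := by
      rw [jacobiSym.quadratic_reciprocity_one_mod_four' ((ht 0).odd_of_ne_two (ht2 0))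
        (by omega : t 1 % 4 = 1), hJ]
    rw [mul_comm]
    exact Or.inl (odd_genusSum₁_genusField_one_seven hR (ht 1) (ht 0) h1 h0 hJ')
  -- (7, 3): swap
  · rw [mul_comm]; exact odd_genusSum_genusField_three_seven hR (ht 1) (ht 0) h1 h0

end Door

end Summit.BirchSwinnertonDyer.Rank1Residual.P2

end
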